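import Literature.NumberTheory.GelbartRogawski1991.LocalDoubledUnitarySplittingDataCM
import HarnessLib

/-!
# Kudla's splitting function `β` of the doubled unitary group is UNITARY: `|β(g)| = 1`

Topic `NumberTheory/GelbartRogawski1991`; namespace
`Literature.NumberTheory.GelbartRogawski1991.UnitaryDualPair.LocalSplitting`.  KERNEL ONLY: theorems; no definition,
no named fact, no `sorry`.  Sequel of the three modules `LocalDoubledUnitarySplittingData{,Split,CM}.lean` (the local
splitting data of `H = U(𝕍 ⊕ −𝕍)(F_v)`: section `r`, Kudla's function `β` with `∂β = c_r ∘ ι`, [Kudla1994, Thm 3.1]).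

* §1 (non-split place, group theory) **`exists_siegel_weyl_siegel_of_isUnit_blkC`** — an element of the big cell
  `Ω_H = {C invertible}` is `p · w_Δ · n` with `p, n ∈ P_Δ(F_v)` ([Kudla1994, §3]: `Ω = P w P`), and
  **`exists_bigCell_mul_mem_bigCell`** — every `t ∈ H(F_v)` has `x ∈ Ω_H` with `x t ∈ Ω_H` ([Weil1964, n° 42]: the
  big cell is generic; tree `exists_skew_isUnit_det`); hence `H(F_v)` is generated by `P_Δ(F_v)` and `w_Δ`
  (`w_Δ² = 1`), and **`norm_eq_one_of_siegel`**: a function `f : H(F_v) → ℂˣ` with `|f(g₁g₂)| = |f(g₁)| |f(g₂)|` and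
  `|f| = 1` on `P_Δ(F_v)` has `|f| = 1` everywhere;
* §2 for a local splitting datum, `|β(g₁g₂)| = |β(g₁)| |β(g₂)|` (`∂β = c_r ∘ ι` and `|c_r| = 1`, a Leray cocycle) and
  `|χ_v(det_Δ p)| = 1` for unitary `χ_w`; so **`norm_beta_nonsplit_eq_one`**: the non-split datum
  (`β|_{P_Δ} = χ_v ∘ det_Δ`, `beta_parabolic`) has `|β| = 1`;
* §3 **`norm_beta_split_eq_one`** — at a split place `β = λ_m(ι g) · χ_w(det g_w)` EXPLICITLY (`betaSplitDoubled`), a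
  Leray–Weil index of modulus one (`norm_stabiliserFun`) times a unitary character;
* §4 **`norm_beta_localSplittingDatumCM_eq_one`** — for the CM data (`χv w = χ_w⁻¹`, `χ` a UNITARY Hecke character of
  the CM field) `|β(g)| = 1` at every finite place.

Use (GR-1 Track 2 of the Hodge/COR-CM cell): with `LocalSplittingIsometricCriterion.lean`
(`isL2Isometric_localOmega ⇐` isometric implementers `+ |β| = 1`) this discharges the `|β| = 1` half for the tree's own
local splitting data; the local Weil representation is then `L²`-isometric as soon as the Schrödinger model has
isometric implementers ([Weil1964, n° 13]).  Nothing of [Kudla1994] / [GelbartRogawski1991] is asserted.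

## References
* [Kudla1994] S. S. Kudla, Israel J. Math. 87 (1994), §3, Thm 3.1.
* [Weil1964] A. Weil, Acta Math. 111 (1964), n° 32, n° 42.
* [HarrisKudlaSweet1996] M. Harris, S. S. Kudla, W. J. Sweet, JAMS 9 (1996), §1 (1.15).
* [GelbartRogawski1991] S. Gelbart, J. Rogawski, Invent. Math. 105 (1991), §3.1 Prop. 3.1.1.
-/

set_option autoImplicit false

noncomputable section

open NumberField IsDedekindDomain MeasureTheory Matrix
open Literature.RepresentationTheory.HeisenbergGroup
open Literature.NumberTheory.Automorphic Literature.NumberTheory.Automorphic.UnitaryGroup Literature.NumberTheory.Weil1964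
open Literature.NumberTheory.GaloisRepresentations.IsNonarchimedeanLocalField
open Literature.GroupTheory Literature.LinearAlgebra.QuadraticForm
open Literature.NumberTheory.GelbartRogawski1991.AdaptedBlocks

namespace Literature.NumberTheory.GelbartRogawski1991.UnitaryDualPair.LocalSplitting

variable (F : Type) [Field F] [NumberField F] (E : Type) [Field E] [NumberField E] [Algebra F E]
  [Algebra.IsQuadraticExtension F E] (c : E ≃ₐ[F] E)
  {δ : E} (hcδ : c δ = -δ) (hδ : δ ≠ 0) {d : F} (hd : δ * δ = algebraMap F E d)
  (v : HeightOneSpectrum (𝓞 F)) (n : ℕ) {T₀ : Matrix (Fin n) (Fin n) F} (hT₀ : T₀.IsSymm) (hT₀d : IsUnit T₀.det)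
  {JD : Matrix (Fin (n + n)) (Fin (n + n)) E} (hJD : JD = (gramD F n T₀).map (algebraMap F E))

/-! ## §1 Non-split place: `Ω_H ⊆ P_Δ w_Δ P_Δ`, genericity, and unit-modulus functions -/

section Generation

include hcδ hδ hd hT₀ hT₀d hJD in
/-- **`Ω_H ⊆ P_Δ · w_Δ · P_Δ`**: if the block `C(Y)` is invertible then `Y = p · w_Δ · n(−ν)` with `p ∈ P_Δ(F_v)` and
`ν = −C⁻¹ D` skew (so `n(−ν) ∈ P_Δ(F_v)`): indeed `Y · n(ν) · w_Δ` has `C`-block `C ν + D = 0`.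
[cite: Kudla1994, §3; Weil1964, n° 32] -/
theorem exists_siegel_weyl_siegel_of_isUnit_blkC (Y : UnitaryGroup.localPi E c (n + n) JD v)
    (hY : IsUnit (blkC (matA F E c v n Y)).det) :
    ∃ p n₁ : UnitaryGroup.localPi E c (n + n) JD v,
      IsSiegelDelta F E c hcδ hδ hd v n hT₀ hJD p ∧ IsSiegelDelta F E c hcδ hδ hd v n hT₀ hJD n₁ ∧
        Y = p * weylDelta F E c v n hJD * n₁ := by
  set C := blkC (matA F E c v n Y) with hC
  set D := blkD (matA F E c v n Y) with hD
  -- `ν = −C⁻¹ D` is skew (inverse relation for `Y ∈ H`)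
  set ν := -(C⁻¹ * D) with hν
  have hνs : (ν.map (conjLocal E c v))ᵀ * gramS F E v n T₀ + gramS F E v n T₀ * ν = 0 := by
    have h := rel_inv₂₂ (σ := conjLocal E c v) (isUnit_det_gramS' F E v n hT₀d) (isUnit_det_matA F E c v n Y)
      (cstar_matA F E c v n hJD Y)
    exact cstar_neg_invMul_skew (isUnit_det_gramS' F E v n hT₀d) hY h
  -- `m = n(ν) w_Δ`, `p = Y m ∈ P_Δ`
  set m := nElem F E c v n hJD ν hνs * weylDelta F E c v n hJD (T₀ := T₀) with hm
  set p := Y * m with hp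
  have hpS : IsSiegelDelta F E c hcδ hδ hd v n hT₀ hJD p := by
    rw [isSiegelDelta_iff_blkC_eq_zero, hp, ← matA_mul, blkC_mul]
    have hmad : adapt (matA F E c v n m) = Matrix.fromBlocks ν 1 1 0 := by
      rw [hm, ← matA_mul, adapt_mul, adapt_matA_nElem, weylDelta, adapt_matA_ofAdapted, Matrix.fromBlocks_multiply]
      simp
    have hblkm := Matrix.fromBlocks_inj.1 ((adapt_eq (matA F E c v n m)).symm.trans hmad)
    rw [hblkm.1, hblkm.2.2.1, Matrix.mul_one, hν, Matrix.mul_neg, Matrix.mul_nonsing_inv_cancel_left _ _ hY,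
      neg_add_cancel]
  -- `Y = p m⁻¹ = p w_Δ n(−ν)`
  refine ⟨p, nElem F E c v n hJD (-ν) (skew_neg F E c v n hνs), hpS,
    isSiegelDelta_nElem F E c hcδ hδ hd v n hT₀ hJD _ _, ?_⟩
  have hm1 : m * (weylDelta F E c v n hJD * nElem F E c v n hJD (-ν) (skew_neg F E c v n hνs)) = 1 := by
    rw [hm, mul_assoc, ← mul_assoc (weylDelta F E c v n hJD), weylDelta_mul_self, one_mul, nElem_mul_nElem_neg]
  calc Y = Y * (m * (weylDelta F E c v n hJD * nElem F E c v n hJD (-ν) (skew_neg F E c v n hνs))) := by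
        rw [hm1, mul_one]
    _ = p * weylDelta F E c v n hJD * nElem F E c v n hJD (-ν) (skew_neg F E c v n hνs) := by
        rw [hp]; simp only [mul_assoc]

include hcδ hδ hd hT₀ hT₀d hJD in
/-- **genericity of the big cell** (non-split `v`): every `t ∈ H(F_v)` has some `x` with `C(x)` and `C(x t)` both
invertible — `x = x(ν)` for a skew `ν` with `det(A_t − ν C_t)` a unit (tree `exists_skew_isUnit_det`); `C(x(ν)) = 1`.
[cite: Weil1964, n° 42; Kudla1994, §3] -/
theorem exists_bigCell_mul_mem_bigCell (w : PlacesOver E v) (hw : c • w.1 = w.1)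
    (t : UnitaryGroup.localPi E c (n + n) JD v) :
    ∃ x : UnitaryGroup.localPi E c (n + n) JD v,
      IsUnit (blkC (matA F E c v n x)).det ∧ IsUnit (blkC (matA F E c v n (x * t))).det := by
  obtain ⟨ν, hν, hu⟩ := exists_skew_isUnit_det F E c hcδ hδ hd v n hT₀ hT₀d hJD w hw t
  refine ⟨xElem F E c v n hJD ν hν, ?_, ?_⟩
  · have h := blkC_matA_xElem_mul F E c v n hJD ν hν 1
    rw [mul_one, matA_one, blkA_one, blkC_one, Matrix.mul_zero, sub_zero] at h
    rw [h, Matrix.det_one]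
    exact isUnit_one
  · rw [blkC_matA_xElem_mul]
    exact hu

include hcδ hδ hd hT₀ hT₀d hJD in
/-- **a multiplicative-in-modulus function with `|f| = 1` on `P_Δ(F_v)` has `|f| = 1` on `H(F_v)`** (non-split `v`):
`|f(w_Δ)|² = |f(w_Δ²)| = |f(1)| = 1`, so `|f| = 1` on `P_Δ w_Δ P_Δ ⊇ Ω_H`, and `t = x⁻¹ (x t)` with `x, x t ∈ Ω_H`.
[cite: Kudla1994, Thm 3.1] [cite: Weil1964, n° 42] -/
theorem norm_eq_one_of_siegel (w : PlacesOver E v) (hw : c • w.1 = w.1)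
    (f : UnitaryGroup.localPi E c (n + n) JD v → ℂˣ)
    (hmul : ∀ g₁ g₂, ‖((f (g₁ * g₂) : ℂˣ) : ℂ)‖ = ‖((f g₁ : ℂˣ) : ℂ)‖ * ‖((f g₂ : ℂˣ) : ℂ)‖)
    (hP : ∀ p, IsSiegelDelta F E c hcδ hδ hd v n hT₀ hJD p → ‖((f p : ℂˣ) : ℂ)‖ = 1)
    (g : UnitaryGroup.localPi E c (n + n) JD v) : ‖((f g : ℂˣ) : ℂ)‖ = 1 := by
  -- `|f(1)| = 1`, `|f(w_Δ)| = 1`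
  have h1 : ‖((f 1 : ℂˣ) : ℂ)‖ = 1 := by
    have h := hmul 1 1
    rw [mul_one] at h
    have hpos : 0 < ‖((f 1 : ℂˣ) : ℂ)‖ := norm_pos_iff.2 (f 1).ne_zero
    nlinarith [h, hpos]
  have hw1 : ‖((f (weylDelta F E c v n hJD (T₀ := T₀)) : ℂˣ) : ℂ)‖ = 1 := by
    have h := hmul (weylDelta F E c v n hJD (T₀ := T₀)) (weylDelta F E c v n hJD)
    rw [weylDelta_mul_self, h1] at h
    have hpos : 0 ≤ ‖((f (weylDelta F E c v n hJD (T₀ := T₀)) : ℂˣ) : ℂ)‖ := norm_nonneg _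
    nlinarith [h, hpos]
  -- `|f| = 1` on the big cell
  have hΩ : ∀ Y : UnitaryGroup.localPi E c (n + n) JD v, IsUnit (blkC (matA F E c v n Y)).det →
      ‖((f Y : ℂˣ) : ℂ)‖ = 1 := by
    intro Y hY
    obtain ⟨p, n₁, hp, hn₁, hYeq⟩ := exists_siegel_weyl_siegel_of_isUnit_blkC F E c hcδ hδ hd v n hT₀ hT₀d hJD Y hY
    rw [hYeq, hmul, hmul, hP p hp, hw1, hP n₁ hn₁, one_mul, one_mul]
  -- `g = x⁻¹ (x g)`
  obtain ⟨x, hx, hxg⟩ := exists_bigCell_mul_mem_bigCell F E c hcδ hδ hd v n hT₀ hT₀d hJD w hw g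
  have h := hmul x g
  rw [hΩ _ hxg, hΩ _ hx, one_mul] at h
  exact h.symm

end Generation

/-! ## §2 `|β| = 1` for the non-split datum -/

section Datum

variable [MeasurableSpace (v.adicCompletion F)] [BorelSpace (v.adicCompletion F)]
  (μ : Measure (v.adicCompletion F)) [μ.IsAddHaarMeasure]

/-- **`|β(g₁ g₂)| = |β(g₁)| |β(g₂)|` for any local splitting datum**: `∂β = c_r ∘ ι` and the multiplier `c_r` is a Leray
cocycle, of modulus one (tree `norm_lerayCocycle`). [cite: Kudla1994, Thm 3.1] -/
theorem LocalSplittingDatum.norm_beta_mul {N : ℕ} {T : Matrix (Fin N) (Fin N) F} {hT : T.IsSymm} {hTd : IsUnit T.det}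
    {J : Matrix (Fin N) (Fin N) E} {hJ : J = T.map (algebraMap F E)}
    {ℓ : Submodule (v.adicCompletion F) ((Fin N → v.adicCompletion F) × (Fin N → v.adicCompletion F))}
    {hℓ : LinearMap.BilinForm.orthogonal (alt (polar (localPairing F N T v))) ℓ = ℓ}
    (D : LocalSplittingDatum F E c N hcδ hδ hd T hT hTd hJ v μ ℓ hℓ) (g₁ g₂ : UnitaryGroup.localPi E c N J v) :
    ‖((D.beta (g₁ * g₂) : ℂˣ) : ℂ)‖ = ‖((D.beta g₁ : ℂˣ) : ℂ)‖ * ‖((D.beta g₂ : ℂˣ) : ℂ)‖ := by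
  have hc : ‖((D.r.cocycle D.hU (iota F E c N hcδ hδ hd T hT hJ v g₁) (iota F E c N hcδ hδ hd T hT hJ v g₂) : ℂˣ) : ℂ)‖ = 1 := by
    obtain ⟨ψ', hψ', h⟩ := D.cocycle_eq
    rw [h, coe_localLeray_apply]
    exact norm_lerayCocycle μ hψ' _ _ _ _
  have h := congrArg (fun u : ℂˣ => ‖(u : ℂ)‖) (D.beta_mul g₁ g₂)
  simp only [Units.val_mul, norm_mul] at h
  rw [hc, mul_one] at h
  exact h

omit [Algebra.IsQuadraticExtension F E] [MeasurableSpace (v.adicCompletion F)] [BorelSpace (v.adicCompletion F)] in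
/-- **`|χ_v(det_Δ p)| = 1`** for unitary local characters `χ_w`. [cite: HarrisKudlaSweet1996, §1 (1.15)] -/
theorem norm_chiDet_eq_one (χv : ∀ w : PlacesOver E v, (w.1.adicCompletion E)ˣ →* ℂˣ)
    (hχu : ∀ (w : PlacesOver E v) (x : (w.1.adicCompletion E)ˣ), ‖((χv w x : ℂˣ) : ℂ)‖ = 1)
    (p : UnitaryGroup.localPi E c (n + n) JD v) : ‖((chiDet F E c v n χv p : ℂˣ) : ℂ)‖ = 1 := by
  classical
  rw [chiDet, Units.coe_prod, norm_prod]
  refine Finset.prod_eq_one fun w _ => ?_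
  split_ifs with hu
  · exact hχu w _
  · rw [Units.val_one, norm_one]

include hT₀ in
/-- **`|β| = 1` for the NON-SPLIT datum** `localSplittingDatumNonsplit` with unitary `χ_w`: `|β|` is multiplicative
(`norm_beta_mul`), `= |χ_v(det_Δ ·)| = 1` on `P_Δ` (`beta_parabolic`), hence `1` everywhere (§1).
[cite: Kudla1994, Thm 3.1] -/
theorem norm_beta_nonsplit_eq_one (w : PlacesOver E v) (hw : c • w.1 = w.1)
    (χv : ∀ w : PlacesOver E v, (w.1.adicCompletion E)ˣ →* ℂˣ) (hχ : IsEpsilonChar F E v d w (χv w))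
    (hχ1 : IsTrivialNearOne F E v w (χv w))
    (hχu : ∀ (w : PlacesOver E v) (x : (w.1.adicCompletion E)ˣ), ‖((χv w x : ℂˣ) : ℂ)‖ = 1)
    (g : UnitaryGroup.localPi E c (n + n) JD v) :
    ‖(((localSplittingDatumNonsplit F E c hcδ hδ hd v μ n hT₀ hT₀d hJD w hw χv hχ hχ1).beta g : ℂˣ) : ℂ)‖ = 1 :=
  norm_eq_one_of_siegel F E c hcδ hδ hd v n hT₀ hT₀d hJD w hw _
    ((localSplittingDatumNonsplit F E c hcδ hδ hd v μ n hT₀ hT₀d hJD w hw χv hχ hχ1).norm_beta_mul F E c hcδ hδ hd v μ)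
    (fun p hp => by
      rw [beta_parabolic F E c hcδ hδ hd v μ n hT₀ hT₀d hJD w hw χv hχ hχ1 p hp]
      exact norm_chiDet_eq_one F E c v n χv hχu p) g

/-! ## §3 `|β| = 1` for the split datum -/

include hT₀ in
/-- **`|β| = 1` for the SPLIT datum**: `β(g) = λ_m(ι g) · χ_w(det g_w)` with `|λ_m| = 1` (a Leray–Weil index, tree
`norm_stabiliserFun`) and `χ_w` unitary. [cite: Kudla1994, Thm 3.1] [cite: HarrisKudlaSweet1996, §1 (1.15)] -/
theorem norm_beta_split_eq_one (w : PlacesOver E v) (hw : c • w.1 ≠ w.1)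
    (χv : ∀ w : PlacesOver E v, (w.1.adicCompletion E)ˣ →* ℂˣ) (hχ1 : IsTrivialNearOne F E v w (χv w))
    (hχu : ∀ (w : PlacesOver E v) (x : (w.1.adicCompletion E)ˣ), ‖((χv w x : ℂˣ) : ℂ)‖ = 1)
    (g : UnitaryGroup.localPi E c (n + n) JD v) :
    ‖(((localSplittingDatumSplit F E c hcδ hδ hd v μ n hT₀ hT₀d hJD w hw χv hχ1).beta g : ℂˣ) : ℂ)‖ = 1 := by
  show ‖((betaSplitDoubled F E c hcδ hδ hd v μ n hT₀ hT₀d hJD w hw (L0D F v μ n hT₀d).hψ' χv g : ℂˣ) : ℂ)‖ = 1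
  rw [betaSplitDoubled, Units.val_mul, norm_mul, hχu, mul_one, betaSplit, coe_stabiliserUnit]
  exact norm_stabiliserFun μ (L0D F v μ n hT₀d).hψ' _ _ _ _

end Datum

/-! ## §4 `|β| = 1` for the CM data at every finite place -/

section CM

open Literature.RepresentationTheory.HarrisKudlaSweet1996 Literature.NumberTheory.GaloisRepresentations

variable (L : Type) [Field L] [NumberField L] [IsCMField L]
  (v : HeightOneSpectrum (𝓞 (maximalRealSubfield L)))
  [MeasurableSpace (v.adicCompletion (maximalRealSubfield L))] [BorelSpace (v.adicCompletion (maximalRealSubfield L))]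
  (μ : Measure (v.adicCompletion (maximalRealSubfield L))) [μ.IsAddHaarMeasure]
  {T₀ : Matrix (Fin n) (Fin n) (maximalRealSubfield L)} (hT₀ : T₀.IsSymm) (hT₀d : IsUnit T₀.det)
  {JD : Matrix (Fin (n + n)) (Fin (n + n)) L}
  (hJD : JD = (gramD (maximalRealSubfield L) n T₀).map (algebraMap (maximalRealSubfield L) L))
  (χ : HeckeCharacter L) (hχ : IsSplittingChar L 1 χ)

omit [IsCMField L] [MeasurableSpace (v.adicCompletion (maximalRealSubfield L))]
  [BorelSpace (v.adicCompletion (maximalRealSubfield L))] in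
/-- the local characters `χ_w⁻¹` are unitary for a unitary Hecke character. [cite: GelbartRogawski1991, §3.1 p. 455] -/
theorem norm_localComponent_inv_eq_one (hχu : χ.IsUnitary) (w : PlacesOver L v) (x : (w.1.adicCompletion L)ˣ) :
    ‖((((χ.localComponent w.1)⁻¹ : (w.1.adicCompletion L)ˣ →* ℂˣ) x : ℂˣ) : ℂ)‖ = 1 := by
  rw [MonoidHom.inv_apply, Units.val_inv_eq_inv_val, norm_inv, HeckeCharacter.localComponent_apply, hχu, inv_one]

/-- **`|β(g)| = 1` for the CM local splitting datum at every finite place** (`χ` a unitary Hecke character of the CM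
field `L` with `χ|_{𝕀_{L⁺}} = ε_{L/L⁺}`): the split datum at a split place (§3), the non-split datum otherwise (§2).
[cite: Kudla1994, Thm 3.1] [cite: GelbartRogawski1991, §3.1 Prop. 3.1.1] -/
theorem norm_beta_localSplittingDatumCM_eq_one (hχu : χ.IsUnitary)
    (g : UnitaryGroup.localPi L (IsCMField.complexConj L) (n + n) JD v) :
    ‖(((localSplittingDatumCM L v μ n hT₀ hT₀d hJD χ hχ).beta g : ℂˣ) : ℂ)‖ = 1 := by
  have hχu' : ∀ (w : PlacesOver L v) (x : (w.1.adicCompletion L)ˣ),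
      ‖((((fun w' : PlacesOver L v => (χ.localComponent w'.1)⁻¹) w) x : ℂˣ) : ℂ)‖ = 1 :=
    fun w x => norm_localComponent_inv_eq_one L v χ hχu w x
  unfold localSplittingDatumCM
  split_ifs with h
  · exact norm_beta_split_eq_one (maximalRealSubfield L) L (IsCMField.complexConj L) (complexConj_imagUnit L)
      (imagUnit_ne_zero L) (imagUnit_mul_self L) v n hT₀ hT₀d hJD μ h.choose h.choose_spec _
      (isTrivialNearOne_localComponent_inv L v χ h.choose) hχu' g
  · exact norm_beta_nonsplit_eq_one (maximalRealSubfield L) L (IsCMField.complexConj L) (complexConj_imagUnit L)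
      (imagUnit_ne_zero L) (imagUnit_mul_self L) v n hT₀ hT₀d hJD μ _ _ _ _ _ hχu' g

end CM

end Literature.NumberTheory.GelbartRogawski1991.UnitaryDualPair.LocalSplitting

end
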